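import Summits.Parity.GeneralizedHardyLittlewood.Theorems.LeeYangFibresRelativeDimOneTypeRigidity
import Summits.Parity.GeneralizedHardyLittlewood.Theorems.LeeYangFibresRelativeDimOneTypeEndgame
import Summits.Parity.GeneralizedHardyLittlewood.Theorems.LeeYangFibresRelativeDimOneSplitEulerExpansion
import Summits.Parity.GeneralizedHardyLittlewood.Theorems.LeeYangFibresRelativeDimOneFloatingSiegelDefs
import Summits.Parity.GeneralizedHardyLittlewood.Theorems.PairsToGHL.Negative.ShiftPairDictionary
import Literature.NumberTheory.Sieve.MontgomeryVaughan1975Tools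
import HarnessLib

/-!
# Route `LeeYangFibres`, crux `RelativeDimOne` (stmt-Parity-14113), line `floating-level-core`:
# the registered stub `stub_pairSumModel` — under the parity atom the pair sums are modelled by a
# bounded function of the small prime divisors of the shift

Under `IncidenceBandlimitedCoreDecay θ` (vocabulary `LeeYangFibresRelativeDimOneTypeDefs`) the prime pair sums
`S_N(h) = Σ_{n ≤ N − h} Λ(n)Λ(n + h)`, `1 ≤ h ≤ N`, are `(N − h) g(h) ± ε(N h/φ(h) + N)` for a function `g` that
sees `h` only through its prime divisors `p ≤ w = wlev D N` and is bounded by `C (w + 1)` (`PairSumModel`,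
vocabulary `LeeYangFibresRelativeDimOneFloatingSiegelDefs`).

Proof. Take the core's spectrum `f` at scale `N` (sizes `≤ 3`, `t = 2` forms) and put
`g(h) = smoothBand ⌊N^θ⌋ w (f a) (0, h)`, the `w`-smooth part of the band sum at the target `(n, n + h)`
(`a = (1, 1)` is the common coefficient vector of all shift pairs).
* Type invariance of `f a` and `incType p a (0, h) = function of gcd(h, p)` give (i).
* Hardy–Littlewood decay gives `|g(h)| ≤ C Σ_{q w-smooth sqfree} wprod q ≤ C G_w(h)`, `G_w = ∏_{p ≤ w}(1 + wt_p)`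
  (`rigidity_sum_divisors_primorial`), and the local factors of `(n, n + h)` (`β_p = p/(p−1)` if `p ∣ h`,
  `1 − 1/(p−1)²` otherwise; `ShiftPairDictionary`) give `1 + wt_p ≤ (p/(p−1))^{[p ∣ h]} (1 + 8/p²)`, whence
  `G_w(h) ≤ e⁸ ∏_{p ≤ w, p ∣ h} p/(p−1) ≤ e⁸ min(w + 1, h/φ(h))` (`Gallagher.prod_primesLE_inv_le`, Euler's
  `∏_{p ∣ h} p/(p−1) = h/φ(h)`); this is (ii) with the constant `C e⁸`.
* The core clause at `Ψ = (n, n + h)`, `K = [-(N − h), N − h]` (Green–Tao dictionary: `S = S_N(h)`, `β_∞ = N − h`)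
  and (R1) of the landed `stub_typeRigidity` (`|F − g| ≤ κ G_w`) give (iii) after the bookkeeping `model_chain`.

References: Green–Tao, Ann. of Math. 171 (2010), Example 1, (1.2), (1.4) [GreenTao2010]; Gallagher, Mathematika 23
(1976) §2 [Gallagher1976].
-/

noncomputable section

open scoped BigOperators Classical ArithmeticFunction.vonMangoldt
open Finset Filter Literature.NumberTheory.Sieve
open Summit.Parity.GeneralizedHardyLittlewood.Cruxes.RelativeDimOne.GallagherBackwards (classPsi charPsi)
open Summit.Parity.GeneralizedHardyLittlewood.Cruxes.RelativeDimOne.GallagherBackwardsSplit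
open Summit.Parity.GeneralizedHardyLittlewood.Cruxes.RelativeDimOne.TypeSplit
open Summit.Parity.GeneralizedHardyLittlewood.Theorems.PairsToGHL.Negative

namespace Summit.Parity.GeneralizedHardyLittlewood.Cruxes.RelativeDimOne.FloatingLevelCore

/-! ### The shift pairs `(n, n + h)`: coefficients, incidence types, type invariance -/

-- adapted from Theorems/LeeYangFibresRelativeDimOneFloatingSiegelRepulsion.lean (private there)
/-- The coefficient vector of `(n, n + h)` is `(1, 1)`, independently of `h`. -/
theorem psm_coeffs_shiftPairSystem_eq (h₁ h₂ : ℤ) :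
    coeffs (shiftPairSystem h₁) = coeffs (shiftPairSystem h₂) := by
  funext i; fin_cases i <;> rfl

-- adapted from Theorems/LeeYangFibresRelativeDimOneFloatingSiegelRepulsion.lean (private there)
/-- The incidence type of `(n, n + h)` modulo `p` depends on `h` only through `gcd(h, p)`. -/
theorem psm_incType_shiftPairSystem_eq {p : ℕ} {h₀ h₁ h₂ : ℤ} (hg : Int.gcd h₁ p = Int.gcd h₂ p) :
    incType p (coeffs (shiftPairSystem h₀)) (consts (shiftPairSystem h₁)) =
      incType p (coeffs (shiftPairSystem h₀)) (consts (shiftPairSystem h₂)) := by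
  unfold incType
  refine Prod.ext ?_ ?_
  · funext i
    fin_cases i <;> simp [coeffs, consts, shiftPairSystem]
  · funext i j
    fin_cases i <;> fin_cases j <;> simp [hg, coeffs, consts, shiftPairSystem]

-- adapted from Theorems/LeeYangFibresRelativeDimOneFloatingSiegelRepulsion.lean (private there)
/-- For a prime `p`: `gcd(h₁, p) = gcd(h₂, p)` as soon as `p ∣ h₁ ↔ p ∣ h₂`. -/
theorem psm_int_gcd_eq_of_dvd_iff {p h₁ h₂ : ℕ} (hp : p.Prime) (hiff : p ∣ h₁ ↔ p ∣ h₂) :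
    Int.gcd (h₁ : ℤ) p = Int.gcd (h₂ : ℤ) p := by
  rw [Int.gcd_natCast_natCast, Int.gcd_natCast_natCast]
  by_cases h1 : p ∣ h₁
  · rw [Nat.gcd_eq_right h1, Nat.gcd_eq_right (hiff.mp h1)]
  · rw [((Nat.Prime.coprime_iff_not_dvd hp).mpr h1).symm.gcd_eq_one,
      ((Nat.Prime.coprime_iff_not_dvd hp).mpr (mt hiff.mpr h1)).symm.gcd_eq_one]

-- adapted from Theorems/LeeYangFibresRelativeDimOneFloatingSiegelRepulsion.lean (private there)
/-- Type invariance: the `w`-smooth band sum sees the target only through its incidence types at primes `≤ w`. -/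
theorem psm_smoothBand_eq_of_incType {t Q w : ℕ} {a b b' : Fin t → ℤ} {e : ℕ → (Fin t → ℤ) → ℝ}
    (he : TypeInvariant a e) (h : ∀ p : ℕ, p.Prime → p ≤ w → incType p a b = incType p a b') :
    smoothBand Q w e b = smoothBand Q w e b' := by
  unfold smoothBand
  refine Finset.sum_congr rfl fun q hq => ?_
  simp only [Finset.mem_filter] at hq
  exact he q hq.1.2 b b' fun p hp => h p (Nat.prime_of_mem_primeFactors hp) (hq.2 p hp)

/-! ### Weights: the smooth band sum is at most `C G_w`, and `G_w(n, n + h) ≤ e⁸ ∏_{p ≤ w, p ∣ h} p/(p−1)` -/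

/-- Hardy–Littlewood decay bounds the `w`-smooth band sum by `C G_w`: the `w`-smooth squarefree moduli divide
`∏_{p ≤ w} p`, and `Σ_{d ∣ ∏_{p ≤ w} p} wprod d = ∏_{p ≤ w} (1 + wt_p) = G_w` (`rigidity_sum_divisors_primorial`). -/
theorem psm_abs_smoothBand_le_gscale {t Q w : ℕ} {C : ℝ} (hC : 0 ≤ C) {a : Fin t → ℤ}
    {e : ℕ → (Fin t → ℤ) → ℝ} (hdec : HasDecay C a e) (b : Fin t → ℤ) :
    |smoothBand Q w e b| ≤ C * gscale w a b := by
  have hG : gscale w a b = ∑ d ∈ (primorial w).divisors, wprod d a b := by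
    unfold gscale wprod
    rw [rigidity_sum_divisors_primorial w (wt a b)]
  unfold smoothBand
  refine (Finset.abs_sum_le_sum_abs _ _).trans ?_
  calc ∑ q ∈ ((Finset.Icc 1 Q).filter Squarefree).filter (fun q => ∀ p ∈ q.primeFactors, p ≤ w), |e q b|
      ≤ ∑ q ∈ ((Finset.Icc 1 Q).filter Squarefree).filter (fun q => ∀ p ∈ q.primeFactors, p ≤ w),
          C * wprod q a b := Finset.sum_le_sum fun q hq => by
        simp only [Finset.mem_filter] at hq
        exact hdec q hq.1.2 b
    _ = C * ∑ q ∈ ((Finset.Icc 1 Q).filter Squarefree).filter (fun q => ∀ p ∈ q.primeFactors, p ≤ w),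
          wprod q a b := by rw [Finset.mul_sum]
    _ ≤ C * ∑ d ∈ (primorial w).divisors, wprod d a b := by
        refine mul_le_mul_of_nonneg_left ?_ hC
        refine Finset.sum_le_sum_of_subset_of_nonneg (fun q hq => ?_) (fun d _ _ => wprod_nonneg d a b)
        simp only [Finset.mem_filter, Finset.mem_Icc] at hq
        exact Nat.mem_divisors.2
          ⟨RigidityProof.dvd_primorial_of_smooth hq.1.1.1 hq.1.2 hq.2, (primorial_pos w).ne'⟩
    _ = C * gscale w a b := by rw [hG]

/-- The local weights of `(n, n + h)`: `1 + wt_p ≤ (p/(p−1))^{[p ∣ h]} · (1 + 8/p²)` (`β_p = p/(p−1)` for `p ∣ h`,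
`β_p = 1 − 1/(p−1)²` for `p ∤ h`; at `p = 2 ∤ h` both sides equal `3`). -/
theorem psm_one_add_wt_le {p h : ℕ} (hp : p.Prime) {a b : Fin 2 → ℤ} (hsys : sys a b = shiftPairSystem (h : ℤ)) :
    1 + wt a b p ≤ (if p ∣ h then (p : ℝ) / ((p : ℝ) - 1) else 1) * (1 + 8 / (p : ℝ) ^ 2) := by
  have hp2 : (2 : ℝ) ≤ p := by exact_mod_cast hp.two_le
  have hp0 : (0 : ℝ) < p := by linarith
  have hp1 : (0 : ℝ) < (p : ℝ) - 1 := by linarith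
  unfold wt
  rw [hsys]
  by_cases hdvd : p ∣ h
  · rw [if_pos hdvd, localFactor_shiftPairSystem_of_dvd hp hdvd]
    have h1 : (p : ℝ) / ((p : ℝ) - 1) - 1 = 1 / ((p : ℝ) - 1) := by
      field_simp
      ring
    rw [h1, abs_of_nonneg (by positivity)]
    have key : (p : ℝ) / ((p : ℝ) - 1) * (1 + 8 / (p : ℝ) ^ 2) -
        (1 + (1 / ((p : ℝ) - 1) + ((2 : ℕ) : ℝ) ^ 2 / (p : ℝ) ^ 2)) =
          (4 * (p : ℝ) + 4) / ((p : ℝ) ^ 2 * ((p : ℝ) - 1)) := by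
      field_simp
      ring
    have hnum : 0 ≤ (4 * (p : ℝ) + 4) / ((p : ℝ) ^ 2 * ((p : ℝ) - 1)) :=
      div_nonneg (by linarith) (mul_nonneg (sq_nonneg _) hp1.le)
    linarith
  · rw [if_neg hdvd, localFactor_shiftPairSystem_of_not_dvd hp hdvd, one_mul]
    have h1 : 1 - 1 / ((p : ℝ) - 1) ^ 2 - 1 = -(1 / ((p : ℝ) - 1) ^ 2) := by ring
    rw [h1, abs_neg, abs_of_nonneg (by positivity)]
    have h2 : 1 / ((p : ℝ) - 1) ^ 2 ≤ 4 / (p : ℝ) ^ 2 := by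
      rw [div_le_div_iff₀ (pow_pos hp1 2) (pow_pos hp0 2)]
      nlinarith [mul_nonneg (by linarith : (0 : ℝ) ≤ 3 * p - 2) (by linarith : (0 : ℝ) ≤ p - 2)]
    have h3 : ((2 : ℕ) : ℝ) ^ 2 / (p : ℝ) ^ 2 = 4 / (p : ℝ) ^ 2 := by norm_num
    have h4 : (8 : ℝ) / (p : ℝ) ^ 2 = 4 / (p : ℝ) ^ 2 + 4 / (p : ℝ) ^ 2 := by ring
    rw [h3, h4]
    linarith

/-- `∏_{p ≤ w} (1 + 8/p²) ≤ e⁸` (`1 + x ≤ eˣ` and `Σ_p 1/p² ≤ Σ_{n ≥ 2} 1/n² ≤ 1`). -/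
theorem psm_prod_primesLE_one_add_le (w : ℕ) : ∏ p ∈ Nat.primesLE w, (1 + 8 / (p : ℝ) ^ 2) ≤ Real.exp 8 := by
  have h1 : ∑ p ∈ Nat.primesLE w, (1 : ℝ) / (p : ℝ) ^ 2 ≤ 1 := by
    have := sum_inv_sq_primes_tail_le 1 w le_rfl
    rwa [Nat.primesLE_one, Finset.sdiff_empty, Nat.cast_one, div_one] at this
  calc ∏ p ∈ Nat.primesLE w, (1 + 8 / (p : ℝ) ^ 2) ≤ Real.exp (∑ p ∈ Nat.primesLE w, 8 / (p : ℝ) ^ 2) :=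
        Real.prod_one_add_le_exp_sum _ (fun p => by positivity)
    _ ≤ Real.exp 8 := by
        refine Real.exp_le_exp.2 ?_
        have h2 : ∑ p ∈ Nat.primesLE w, 8 / (p : ℝ) ^ 2 = 8 * ∑ p ∈ Nat.primesLE w, 1 / (p : ℝ) ^ 2 := by
          rw [Finset.mul_sum]
          exact Finset.sum_congr rfl fun p _ => by ring
        rw [h2]
        linarith

/-- The smooth scale of `(n, n + h)`: `G_w ≤ e⁸ ∏_{p ≤ w, p ∣ h} p/(p−1)`. -/
theorem psm_gscale_le {w h : ℕ} {a b : Fin 2 → ℤ} (hsys : sys a b = shiftPairSystem (h : ℤ)) :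
    gscale w a b ≤ Real.exp 8 * ∏ p ∈ (Nat.primesLE w).filter (· ∣ h), (p : ℝ) / ((p : ℝ) - 1) := by
  have hfac : ∀ p ∈ Nat.primesLE w, (0 : ℝ) ≤ (p : ℝ) / ((p : ℝ) - 1) := fun p hp => by
    have hp2 : (2 : ℝ) ≤ p := by exact_mod_cast (Nat.prime_of_mem_primesLE hp).two_le
    exact div_nonneg (by linarith) (by linarith)
  unfold gscale
  calc ∏ p ∈ Nat.primesLE w, (1 + wt a b p)
      ≤ ∏ p ∈ Nat.primesLE w, ((if p ∣ h then (p : ℝ) / ((p : ℝ) - 1) else 1) * (1 + 8 / (p : ℝ) ^ 2)) :=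
        Finset.prod_le_prod (fun p _ => by have := wt_nonneg a b p; linarith) fun p hp =>
          psm_one_add_wt_le (Nat.prime_of_mem_primesLE hp) hsys
    _ = (∏ p ∈ (Nat.primesLE w).filter (· ∣ h), (p : ℝ) / ((p : ℝ) - 1)) *
          ∏ p ∈ Nat.primesLE w, (1 + 8 / (p : ℝ) ^ 2) := by
        rw [Finset.prod_mul_distrib, Finset.prod_filter]
    _ ≤ (∏ p ∈ (Nat.primesLE w).filter (· ∣ h), (p : ℝ) / ((p : ℝ) - 1)) * Real.exp 8 :=
        mul_le_mul_of_nonneg_left (psm_prod_primesLE_one_add_le w)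
          (Finset.prod_nonneg fun p hp => hfac p (Finset.mem_filter.mp hp).1)
    _ = _ := mul_comm _ _

/-- `∏_{p ≤ w, p ∣ h} p/(p−1) ≤ ∏_{p ≤ w} p/(p−1) ≤ w + 1` (telescoping over all `2 ≤ n ≤ w`,
`Gallagher.prod_primesLE_inv_le`). -/
theorem psm_prod_filter_dvd_le_succ (w h : ℕ) :
    ∏ p ∈ (Nat.primesLE w).filter (· ∣ h), (p : ℝ) / ((p : ℝ) - 1) ≤ (w : ℝ) + 1 := by
  have h1 : ∏ p ∈ (Nat.primesLE w).filter (· ∣ h), (p : ℝ) / ((p : ℝ) - 1) ≤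
      ∏ p ∈ Nat.primesLE w, (p : ℝ) / ((p : ℝ) - 1) := by
    refine Finset.prod_le_prod_of_subset_of_one_le (Finset.filter_subset _ _) (fun p hp => ?_)
      (fun p hp _ => ?_)
    · have hp2 : (2 : ℝ) ≤ p := by exact_mod_cast (Nat.prime_of_mem_primesLE (Finset.mem_filter.mp hp).1).two_le
      exact div_nonneg (by linarith) (by linarith)
    · have hp2 : (2 : ℝ) ≤ p := by exact_mod_cast (Nat.prime_of_mem_primesLE hp).two_le
      exact (one_le_div (by linarith)).mpr (by linarith)
  rcases Nat.eq_zero_or_pos w with rfl | hw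
  · simp
  · have h2 : ∏ p ∈ Nat.primesLE w, (p : ℝ) / ((p : ℝ) - 1) = ∏ p ∈ Nat.primesLE w, (1 - 1 / (p : ℝ))⁻¹ :=
      Finset.prod_congr rfl fun p hp => by
        have hp0 : (p : ℝ) ≠ 0 := by exact_mod_cast (Nat.prime_of_mem_primesLE hp).ne_zero
        rw [one_sub_div hp0, inv_div]
    have h3 := Literature.NumberTheory.Sieve.Gallagher.prod_primesLE_inv_le w hw
    rw [← h2] at h3
    linarith

/-- `∏_{p ≤ w, p ∣ h} p/(p−1) ≤ ∏_{p ∣ h} p/(p−1) = h/φ(h)` for `h ≠ 0` (Euler). -/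
theorem psm_prod_filter_dvd_le_div_totient (w : ℕ) {h : ℕ} (hh : h ≠ 0) :
    ∏ p ∈ (Nat.primesLE w).filter (· ∣ h), (p : ℝ) / ((p : ℝ) - 1) ≤ (h : ℝ) / (Nat.totient h : ℝ) := by
  rw [← MontgomeryVaughan1975.prod_primeFactors_div_eq hh]
  refine Finset.prod_le_prod_of_subset_of_one_le (fun p hp => ?_) (fun p hp => ?_) (fun p hp _ => ?_)
  · obtain ⟨hp1, hp2⟩ := Finset.mem_filter.mp hp
    exact Nat.mem_primeFactors.mpr ⟨Nat.prime_of_mem_primesLE hp1, hp2, hh⟩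
  · have hp2 : (2 : ℝ) ≤ p := by exact_mod_cast (Nat.prime_of_mem_primesLE (Finset.mem_filter.mp hp).1).two_le
    exact div_nonneg (by linarith) (by linarith)
  · have hp2 : (2 : ℝ) ≤ p := by exact_mod_cast (Nat.prime_of_mem_primeFactors hp).two_le
    exact (one_le_div (by linarith)).mpr (by linarith)

/-! ### Real bookkeeping -/

/-- The model chain: from the core clause `|S − M F| ≤ ε_P (M|F| + N)`, rigidity `|F − g| ≤ κ G`, decay `|g| ≤ C G`,
the weight bound `G ≤ E ρ`, `0 ≤ M ≤ N`, `0 ≤ ρ` and `E(ε_P(C + κ) + κ) ≤ ε`, `ε_P ≤ ε`: `|S − M g| ≤ ε N ρ + ε N`. -/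
theorem psm_model_chain {S M N F g G C κ εP ε E ρ : ℝ} (hM0 : 0 ≤ M) (hMN : M ≤ N) (hρ0 : 0 ≤ ρ) (hC : 0 ≤ C) (hκ0 : 0 ≤ κ) (hεP0 : 0 ≤ εP) (hεPε : εP ≤ ε)
    (hA : E * (εP * (C + κ) + κ) ≤ ε) (hGρ : G ≤ E * ρ)
    (hcl : |S - M * F| ≤ εP * (M * |F| + N)) (hR : |F - g| ≤ κ * G) (hg : |g| ≤ C * G) :
    |S - M * g| ≤ ε * N * ρ + ε * N := by
  have hN0 : 0 ≤ N := hM0.trans hMN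
  have h1 : |S - M * g| ≤ |S - M * F| + M * |F - g| := by
    calc |S - M * g| = |(S - M * F) + M * (F - g)| := by ring_nf
      _ ≤ |S - M * F| + |M * (F - g)| := abs_add_le _ _
      _ = |S - M * F| + M * |F - g| := by rw [abs_mul, abs_of_nonneg hM0]
  have h2 : |F| ≤ (C + κ) * G := by
    have := abs_sub_abs_le_abs_sub F g
    linarith
  have h3 : M * |F| ≤ N * ((C + κ) * G) := mul_le_mul hMN h2 (abs_nonneg _) hN0
  have h4 : M * |F - g| ≤ N * (κ * G) := mul_le_mul hMN hR (abs_nonneg _) hN0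
  have h5 : εP * (M * |F| + N) ≤ εP * (N * ((C + κ) * G) + N) :=
    mul_le_mul_of_nonneg_left (by linarith) hεP0
  have hA0 : 0 ≤ εP * (C + κ) + κ := by positivity
  have h6 : N * G * (εP * (C + κ) + κ) ≤ N * (E * ρ) * (εP * (C + κ) + κ) :=
    mul_le_mul_of_nonneg_right (mul_le_mul_of_nonneg_left hGρ hN0) hA0
  have h7 : N * ρ * (E * (εP * (C + κ) + κ)) ≤ N * ρ * ε := mul_le_mul_of_nonneg_left hA (mul_nonneg hN0 hρ0)
  have h8 : εP * N ≤ ε * N := mul_le_mul_of_nonneg_right hεPε hN0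
  calc |S - M * g| ≤ |S - M * F| + M * |F - g| := h1
    _ ≤ εP * (N * ((C + κ) * G) + N) + N * (κ * G) := by linarith
    _ = N * G * (εP * (C + κ) + κ) + εP * N := by ring
    _ ≤ N * (E * ρ) * (εP * (C + κ) + κ) + ε * N := add_le_add h6 h8
    _ = N * ρ * (E * (εP * (C + κ) + κ)) + ε * N := by ring
    _ ≤ N * ρ * ε + ε * N := by linarith
    _ = ε * N * ρ + ε * N := by ring

/-! ### The stub -/

/-- **`stub_pairSumModel` (M)** — under the atom P′ at level `θ`, the pair sums are modelled by a function of the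
small prime divisors of the shift: with the core's spectrum `f` at scale `N` (`t = 2`, sizes `≤ 3`) put
`g(h) = smoothBand ⌊N^θ⌋ w (f a) (0, h)`, `w = wlev D N`, `a = (1, 1)`. Then (i) `g` sees `h` only through
`{p ≤ w : p ∣ h}` (type invariance); (ii) `|g(h)| ≤ C G_w(h) ≤ C e⁸ (w + 1)` (decay and the weight bound
`G_w(h) ≤ e⁸ ∏_{p ≤ w, p ∣ h} p/(p−1)`); (iii) the core clause at `Ψ = (n, n + h)`, `K = [-(N − h), N − h]`
(`S = Σ_{n ≤ N−h} Λ(n)Λ(n+h)`, `β_∞ = N − h`) and (R1) of `stub_typeRigidity` (`|F − g| ≤ κ G_w ≤ κ e⁸ h/φ(h)`) give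
`|S_N(h) − (N − h) g(h)| ≤ ε(N h/φ(h) + N)` once `e⁸(ε_P(C + κ) + κ) ≤ ε`. -/
theorem stub_pairSumModel : ∀ θ : ℝ, 0 < θ → IncidenceBandlimitedCoreDecay θ → PairSumModel := by
  intro θ _hθ hP
  obtain ⟨C, hC, hP'⟩ := hP 2 3 (by norm_num)
  refine ⟨C * Real.exp 8, by positivity, fun D hD ε hε => ?_⟩
  -- constants `κ`, `ε_P` with `e⁸ (ε_P (C + κ) + κ) ≤ ε`, `ε_P ≤ ε`
  obtain ⟨κ, hκdef⟩ : ∃ κ : ℝ, κ = min 1 (ε / (2 * Real.exp 8)) := ⟨_, rfl⟩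
  have hκ : 0 < κ := by rw [hκdef]; exact lt_min one_pos (by positivity)
  have hκ1 : κ ≤ 1 := by rw [hκdef]; exact min_le_left _ _
  have hκ2 : κ * (2 * Real.exp 8) ≤ ε := by
    have h := min_le_right 1 (ε / (2 * Real.exp 8))
    rw [← hκdef, le_div_iff₀ (by positivity)] at h
    exact h
  obtain ⟨εP, hεPdef⟩ : ∃ εP : ℝ, εP = min ε (ε / (2 * Real.exp 8 * (C + 1))) := ⟨_, rfl⟩
  have hεP : 0 < εP := by rw [hεPdef]; exact lt_min hε (by positivity)
  have hεPε : εP ≤ ε := by rw [hεPdef]; exact min_le_left _ _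
  have hεP2 : εP * (2 * Real.exp 8 * (C + 1)) ≤ ε := by
    have h := min_le_right ε (ε / (2 * Real.exp 8 * (C + 1)))
    rw [← hεPdef, le_div_iff₀ (by positivity)] at h
    exact h
  have hA : Real.exp 8 * (εP * (C + κ) + κ) ≤ ε := by
    have h1 : Real.exp 8 * εP * κ ≤ Real.exp 8 * εP * 1 := mul_le_mul_of_nonneg_left hκ1 (by positivity)
    linarith
  -- thresholds: the core at accuracy `ε_P`, type rigidity at `(t, L, D, C, κ) = (2, 3, D, C, κ)`, and `N ≥ 1`
  obtain ⟨N₁, hN₁⟩ := hP' εP hεP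
  obtain ⟨N₂, hN₂⟩ := stub_typeRigidity 2 3 D C κ (by norm_num) hD hC hκ
  refine ⟨max N₁ (max N₂ 1), fun N hN => ?_⟩
  have hNN₁ : N₁ ≤ N := le_of_max_le_left hN
  have hNN₂ : N₂ ≤ N := le_of_max_le_left (le_of_max_le_right hN)
  have hN1 : 1 ≤ N := le_of_max_le_right (le_of_max_le_right hN)
  obtain ⟨f, hInv, hDec, hApprox⟩ := hN₁ N hNN₁
  -- the common coefficient vector `a = (1, 1)` of the shift pairs, and the witness `g`
  set a : Fin 2 → ℤ := coeffs (shiftPairSystem (0 : ℤ)) with ha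
  have hsys : ∀ h : ℕ, sys a (consts (shiftPairSystem (h : ℤ))) = shiftPairSystem (h : ℤ) := fun h => by
    rw [ha, psm_coeffs_shiftPairSystem_eq 0 (h : ℤ)]
    exact sys_coeffs_consts _
  refine ⟨fun h => smoothBand (level θ N) (wlev D N) (f a) (consts (shiftPairSystem (h : ℤ))), ?_, ?_, ?_⟩
  · -- (i) type invariance
    intro h₁ h₂ hiff
    refine psm_smoothBand_eq_of_incType (hInv a) fun p hp hpw => ?_
    rw [ha]
    exact psm_incType_shiftPairSystem_eq (psm_int_gcd_eq_of_dvd_iff hp (hiff p hp hpw))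
  · -- (ii) the sup bound `|g h| ≤ C G_w ≤ C e⁸ (w + 1)`
    intro h
    calc |smoothBand (level θ N) (wlev D N) (f a) (consts (shiftPairSystem (h : ℤ)))|
        ≤ C * gscale (wlev D N) a (consts (shiftPairSystem (h : ℤ))) :=
          psm_abs_smoothBand_le_gscale hC.le (hDec a) _
      _ ≤ C * (Real.exp 8 * ((wlev D N : ℝ) + 1)) :=
          mul_le_mul_of_nonneg_left ((psm_gscale_le (hsys h)).trans
            (mul_le_mul_of_nonneg_left (psm_prod_filter_dvd_le_succ _ h) (Real.exp_pos 8).le)) hC.le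
      _ = C * Real.exp 8 * ((wlev D N : ℝ) + 1) := by ring
  · -- (iii) the approximation for `1 ≤ h ≤ N`
    intro h h1 hhN
    have hh0 : h ≠ 0 := by omega
    have hnd : IsNondegenerateSystem (shiftPairSystem (h : ℤ)) :=
      isNondegenerateSystem_shiftPairSystem_iff.mpr (by exact_mod_cast hh0)
    have hsz : affLinSize (shiftPairSystem (h : ℤ)) (N : ℝ) ≤ ((3 : ℕ) : ℝ) :=
      affLinSize_shiftPairSystem_le hN1 hhN
    have hndS : IsNondegenerateSystem (sys a (consts (shiftPairSystem (h : ℤ)))) := by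
      rw [hsys h]; exact hnd
    obtain ⟨hab, hbb⟩ := EndgameProof.coeff_bounds (L := 3) hN1 hndS (by rw [hsys h]; exact hsz)
    -- (R1) of type rigidity at the target `(0, h)`
    have hR := (hN₂ N hNN₂ (level θ N) a hab (f a) (hInv a) (hDec a) _ hbb hndS).1
    -- the core clause at `(n, n + h)` on `K = [-(N - h), N - h]` in the Green–Tao dictionary
    have hconv : Convex ℝ (realBox 1 ((N - h : ℕ) : ℝ)) := convex_Icc _ _
    have hsub : realBox 1 ((N - h : ℕ) : ℝ) ⊆ realBox 1 (N : ℝ) := by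
      have hle : ((N - h : ℕ) : ℝ) ≤ N := by exact_mod_cast Nat.sub_le N h
      exact Set.Icc_subset_Icc (fun _ => neg_le_neg hle) (fun _ => hle)
    have hcl := hApprox _ hnd hsz _ hconv hsub
    rw [GallagherBackwards.vonMangoldtSum_realBox_of_le _ (Nat.sub_le N h), vonMangoldtSum_shiftPairSystem,
      archFactor_shiftPairSystem, psm_coeffs_shiftPairSystem_eq (h : ℤ) 0, ← ha] at hcl
    -- weights: `G_w ≤ e⁸ h/φ(h)`, `|g h| ≤ C G_w`
    have hGρ : gscale (wlev D N) a (consts (shiftPairSystem (h : ℤ))) ≤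
        Real.exp 8 * ((h : ℝ) / (Nat.totient h : ℝ)) :=
      (psm_gscale_le (hsys h)).trans
        (mul_le_mul_of_nonneg_left (psm_prod_filter_dvd_le_div_totient _ hh0) (Real.exp_pos 8).le)
    have hg : |smoothBand (level θ N) (wlev D N) (f a) (consts (shiftPairSystem (h : ℤ)))| ≤
        C * gscale (wlev D N) a (consts (shiftPairSystem (h : ℤ))) :=
      psm_abs_smoothBand_le_gscale hC.le (hDec a) _
    exact psm_model_chain (Nat.cast_nonneg _) (by exact_mod_cast Nat.sub_le N h) (by positivity) hC.le hκ.le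
      hεP.le hεPε hA hGρ hcl hR hg

end Summit.Parity.GeneralizedHardyLittlewood.Cruxes.RelativeDimOne.FloatingLevelCore

end
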